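import Summits.AtomisticToContinuum.HydrodynamicLimit.Theorems.InformationPercolationEnginePercolationClosesChaosCesaroTransfer
import HarnessLib

/-!
# Local equilibrium S5 of the line `equilibrium-forecast-chain-rule` (crux `InformationPercolationEngine.PercolationClosesChaos`,
stmt-AtomisticToContinuum-15178) — piece T′: the event transfer in the `lintegral` currency of the kinetic statements

Support file (`--supports stmt-AtomisticToContinuum-15178`), sequel of `…CesaroTransfer.lean` (piece T, `exists_lgTransferConst`).
`CoarseLocalMaxwellianity`, `LocalCountUI` (ii), `NoMesoscopicOscillation` (ii) and `KineticCellChaosLG` are typed with LOWER LEBESGUE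
integrals `∫⁻ z, ENNReal.ofReal (unitAvg …) ∂LG ≤ ENNReal.ofReal δ`, while piece T speaks Bochner. This file gives the twin the stubs
consume without any measurability of the unit average (lower integrals are monotone on arbitrary functions; the exceedance set is
replaced by its measurable hull):

* `lintegral_ofReal_le_add_mul_measure` — `0 ≤ F ≤ M` ⇒ `∫⁻ ofReal F dμ ≤ ofReal δ' + ofReal M · μ{δ' < F}`;
* `lintegral_ofReal_le_of_measure_le_exp` (registered helper, the headline) — with `ν{δ' < F} ≤ e^{-L(N+1)}` and
  `KL(μ‖ν) ≤ A(N+1)`: `∫⁻ ofReal F dμ ≤ ofReal (δ' + M (log 2 + A)/L)`;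
* `lintegral_ofReal_lg_le` — the same read through `exists_lgTransferConst`'s constant for `LG`/`eqLaw`.
-/

noncomputable section

open MeasureTheory Set Filter Topology
open scoped ENNReal BigOperators Classical
open Literature.Analysis.FluidPDE Literature.MathematicalPhysics.KineticTheory
open Literature.MathematicalPhysics.KineticTheory.VelocityBlindPlacement

namespace Summit.AtomisticToContinuum.HydrodynamicLimit.Theorems.EquilibriumForecastLine

/-- **Markov-complement step for lower integrals, junk-free.** For ANY `F ≤ M` and any real `δ'`:
`∫⁻ ofReal F dμ ≤ ofReal δ' · μ univ + ofReal M · μ{δ' < F}`. [folklore] -/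
theorem lintegral_ofReal_le_add_mul_measure {Ω : Type*} [MeasurableSpace Ω] (μ : Measure Ω) (F : Ω → ℝ) (δ' : ℝ) {M : ℝ}
    (hFM : ∀ x, F x ≤ M) :
    ∫⁻ x, ENNReal.ofReal (F x) ∂μ ≤ ENNReal.ofReal δ' * μ univ + ENNReal.ofReal M * μ {x | δ' < F x} := by
  set S := toMeasurable μ {x | δ' < F x} with hS
  have hSm : MeasurableSet S := measurableSet_toMeasurable μ _
  have hsub : {x | δ' < F x} ⊆ S := subset_toMeasurable μ _
  have hle : ∀ x, ENNReal.ofReal (F x) ≤ ENNReal.ofReal δ' + S.indicator (fun _ => ENNReal.ofReal M) x := by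
    intro x
    by_cases hx : δ' < F x
    · rw [Set.indicator_of_mem (hsub hx)]
      exact (ENNReal.ofReal_le_ofReal (hFM x)).trans le_add_self
    · rw [not_lt] at hx
      exact (ENNReal.ofReal_le_ofReal hx).trans le_self_add
  calc ∫⁻ x, ENNReal.ofReal (F x) ∂μ ≤ ∫⁻ x, ENNReal.ofReal δ' + S.indicator (fun _ => ENNReal.ofReal M) x ∂μ :=
        lintegral_mono hle
    _ = ENNReal.ofReal δ' * μ univ + ENNReal.ofReal M * μ S := by
        rw [lintegral_add_left measurable_const, lintegral_const, lintegral_indicator_const hSm]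
    _ = _ := by rw [hS, measure_toMeasurable]

/-- **Registered helper `lintegral_ofReal_le_of_measure_le_exp` (piece T′ of S5/S6): the in-mean LD transfer in the `lintegral`
currency.** For probability laws `μ, ν` with `KL(μ‖ν) ≤ A(N+1)`, ANY `F` with `0 ≤ F ≤ M`, `δ' ≥ 0`, `L > 0` and
`ν{δ' < F} ≤ e^{-L(N+1)}`: `∫⁻ ofReal F dμ ≤ ofReal (δ' + M (log 2 + A)/L)`. [folklore] -/
theorem lintegral_ofReal_le_of_measure_le_exp : ∀ {Ω : Type} [MeasurableSpace Ω] (μ ν : Measure Ω) [IsProbabilityMeasure μ] [IsProbabilityMeasure ν] (F : Ω → ℝ) {δ' M A L : ℝ}, 0 ≤ δ' → 0 ≤ M → (∀ x, F x ≤ M) → 0 ≤ A → 0 < L → ∀ (N : ℕ), ν {x | δ' < F x} ≤ ENNReal.ofReal (Real.exp (-(L * ((N : ℝ) + 1)))) → InformationTheory.klDiv μ ν ≤ ENNReal.ofReal (A * ((N : ℝ) + 1)) → ∫⁻ x, ENNReal.ofReal (F x) ∂μ ≤ ENNReal.ofReal (δ' + M * ((Real.log 2 + A) / L)) := by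
  intro Ω _ μ ν _ _ F δ' M A L hδ' hM hFM hA hL N hE hKL
  have h1 := lintegral_ofReal_le_add_mul_measure μ F δ' hFM
  rw [measure_univ, mul_one] at h1
  have h2 := toReal_measure_le_of_klDiv_le_linear μ ν {x | δ' < F x} hA hL N hE hKL
  have hq : 0 ≤ (Real.log 2 + A) / L := by
    have := Real.log_pos one_lt_two
    positivity
  have h3 : μ {x | δ' < F x} ≤ ENNReal.ofReal ((Real.log 2 + A) / L) := by
    rw [← ENNReal.ofReal_toReal (measure_ne_top μ _)]
    exact ENNReal.ofReal_le_ofReal h2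
  calc ∫⁻ x, ENNReal.ofReal (F x) ∂μ ≤ ENNReal.ofReal δ' + ENNReal.ofReal M * μ {x | δ' < F x} := h1
    _ ≤ ENNReal.ofReal δ' + ENNReal.ofReal M * ENNReal.ofReal ((Real.log 2 + A) / L) := by gcongr
    _ = ENNReal.ofReal (δ' + M * ((Real.log 2 + A) / L)) := by
        rw [← ENNReal.ofReal_mul hM, ← ENNReal.ofReal_add hδ' (mul_nonneg hM hq)]

/-- The `lintegral` transfer for the line's laws: with the constant `A` of `exists_lgTransferConst` (any `A ≥ 0` carrying the KL
budget), `eqLaw{δ' < F} ≤ e^{-L(N+1)}` and `0 ≤ F ≤ M` give `∫⁻ ofReal F dLG ≤ ofReal (δ' + M (log 2 + A)/L)` (`σ ≤ 1/2`,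
continuous positive profiles). [folklore] -/
theorem lintegral_ofReal_lg_le {a₀ θ₀ : T3 → ℝ} {u₀ : T3 → V3} (ha : Continuous a₀) (hθ : Continuous θ₀) (hu : Continuous u₀)
    (ha0 : ∀ x, 0 < a₀ x) (hθ0 : ∀ x, 0 < θ₀ x) {σ : ℝ} (hσ2 : σ ≤ 1 / 2) {A : ℝ} (hA : 0 ≤ A) (N : ℕ) (Φ : Flow σ N)
    (hKL : InformationTheory.klDiv (localGibbsLaw σ a₀ u₀ θ₀ N Φ) (eqLaw σ N Φ) ≤ ENNReal.ofReal (A * ((N : ℝ) + 1)))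
    (F : Phase N → ℝ) {δ' M L : ℝ} (hδ' : 0 ≤ δ') (hM : 0 ≤ M) (hFM : ∀ z, F z ≤ M) (hL : 0 < L)
    (hE : eqLaw σ N Φ {z | δ' < F z} ≤ ENNReal.ofReal (Real.exp (-(L * ((N : ℝ) + 1))))) :
    ∫⁻ z, ENNReal.ofReal (F z) ∂(localGibbsLaw σ a₀ u₀ θ₀ N Φ) ≤ ENNReal.ofReal (δ' + M * ((Real.log 2 + A) / L)) := by
  haveI : IsProbabilityMeasure (localGibbsLaw σ a₀ u₀ θ₀ N Φ) :=
    isProbabilityMeasure_localGibbsLaw ha hθ hu ha0 hθ0 hσ2 N Φ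
  haveI : IsProbabilityMeasure (eqLaw σ N Φ) :=
    isProbabilityMeasure_localGibbsLaw (a₀ := fun _ => (1 : ℝ)) (θ₀ := fun _ => (1 : ℝ)) (u₀ := fun _ => (0 : V3))
      continuous_const continuous_const continuous_const (fun _ => one_pos) (fun _ => one_pos) hσ2 N Φ
  exact lintegral_ofReal_le_of_measure_le_exp _ _ F hδ' hM hFM hA hL N hE hKL

end Summit.AtomisticToContinuum.HydrodynamicLimit.Theorems.EquilibriumForecastLine

end
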